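import Summits.Ventures.PercRepro2.CaseOneMarkLeafB
import Summits.Ventures.PercRepro2.CaseOneMovesAnchors

/-!
# The marks `o` and `b` pendant at each other: every statement vertex is closed
(blind cell PercRepro2, p1 g29; the last two mark-leaf classes — `CaseOneMarkLeaf` /
`CaseOneMarkLeafB` did the marks pendant at a ROOT)

If `o` is a leaf at `b` through `e₀` (`o ∉ {a₁, a₂}`), then `{o ∈ C₂} = {e₀ open} ∩ {b ∈ C₂}` and the
leaf edge is independent of every event among the other vertices: the `o`-masses of the case-1 forms
factor, `P(Q, a₃ ∈ C₁, o ∈ C₂) = p(e₀) · P(Q, b ∈ C₂, a₃ ∈ C₁)` and `{b ∈ C₁, o ∈ C₂} ∩ Q = ∅`. The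
forms become, at every pair `(c₀, c₁)` with `c₀, c₁ ≥ 0`,
`(ii-t) = c₁ p(e₀) P(Q, b ∈ C₂, a₃ ∈ C₁) [P(Q) − P(Q, b ∈ C₂)] + c₀ [P(Q, b ∈ C₂) P(Q, a₃ ∈ C₁) − P(Q) P(Q, b ∈ C₂, a₃ ∈ C₁)] ≥ 0`
(BHK 1.4, cross-cluster) and
`(i-t) = c₁ p(e₀) P(Q, b ∈ C₁) P(Q, b ∈ C₂, a₃ ∈ C₁) + c₀ [P(Q) P(Q, b ∈ C₁, a₃ ∈ C₁) − P(Q, b ∈ C₁) P(Q, a₃ ∈ C₁)] ≥ 0`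
(BHK 1.3, same cluster): **`closedAt_of_o_leaf_b`** — every statement vertex is closed. Symmetrically
for `b` a leaf at `o` (`b ∉ {a₁, a₂}`): `{b ∈ C₂} = {e₀ open} ∩ {o ∈ C₂}`, `{b ∈ C₁} = {e₀ open} ∩ {o ∈ C₁}`,
and the forms are `p(e₀) ·` the same brackets with `o` in place of `b`: **`closedAt_of_b_leaf_o`**. With
the pocket reduction (`closedAt_of_pocket'`): a mark alone in a mark-free-otherwise pocket hanging at
the other mark (**`closedAt_of_o_pocket_b`**, **`closedAt_of_b_pocket_o`**). With `CaseOneMarkLeaf` /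
`CaseOneMarkLeafB`: a mark pendant at ANY other mark closes every statement vertex. Own code;
standard axioms.
-/

namespace Summit.Ventures.PercRepro2

namespace CaseOne

/-! ## `o` a leaf at `b` -/

section OLeafB
variable {V : Type*} {E : Type*} [Fintype E] [DecidableEq E] [Fintype V] [DecidableEq V]
  {R : Type*} [CommRing R] [LinearOrder R] [IsStrictOrderedRing R]
variable {ends : E → Sym2 V} {o a₁ a₂ a₃ b : V} {e₀ : E}

omit [Fintype E] [DecidableEq E] [Fintype V] [DecidableEq V] in
/-- `{b ∈ C₂} ∩ {a₃ ∈ C₁} ∩ {o ∈ C₂} ∩ Q = {b ↔ o} ∩ ({b ∈ C₂} ∩ {a₃ ∈ C₁} ∩ Q)` for `o` a leaf at `b`. -/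
lemma ob_event_eq₁ (hl : IsLeafAt ends b o e₀) (h2 : a₂ ≠ o) :
    connEvent ends a₂ b ∩ connEvent ends a₁ a₃ ∩ connEvent ends a₂ o ∩ (connEvent ends a₁ a₂)ᶜ =
      connEvent ends b o ∩ (connEvent ends a₂ b ∩ connEvent ends a₁ a₃ ∩
        (connEvent ends a₁ a₂)ᶜ) := by
  ext ω
  simp only [Set.mem_inter_iff, mem_connEvent, Set.mem_compl_iff]
  rw [conn_leaf_at_iff hl ω h2, conn_leaf_iff hl ω]
  tauto

omit [Fintype E] [DecidableEq E] [Fintype V] [DecidableEq V] in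
/-- `{a₃ ∈ C₁} ∩ {o ∈ C₂} ∩ Q = {b ↔ o} ∩ ({b ∈ C₂} ∩ {a₃ ∈ C₁} ∩ Q)` for `o` a leaf at `b`. -/
lemma ob_event_eq₂ (hl : IsLeafAt ends b o e₀) (h2 : a₂ ≠ o) :
    connEvent ends a₁ a₃ ∩ connEvent ends a₂ o ∩ (connEvent ends a₁ a₂)ᶜ =
      connEvent ends b o ∩ (connEvent ends a₂ b ∩ connEvent ends a₁ a₃ ∩
        (connEvent ends a₁ a₂)ᶜ) := by
  ext ω
  simp only [Set.mem_inter_iff, mem_connEvent, Set.mem_compl_iff]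
  rw [conn_leaf_at_iff hl ω h2, conn_leaf_iff hl ω]
  tauto

omit [Fintype E] [DecidableEq E] [Fintype V] [DecidableEq V] in
/-- `{b ∈ C₁} ∩ {a₃ ∈ C₁} ∩ {o ∈ C₂} ∩ Q = ∅` for `o` a leaf at `b`: `o ∈ C₂` forces `b ∈ C₂`. -/
lemma ob_event_eq_empty (hl : IsLeafAt ends b o e₀) (h2 : a₂ ≠ o) :
    connEvent ends a₁ b ∩ connEvent ends a₁ a₃ ∩ connEvent ends a₂ o ∩ (connEvent ends a₁ a₂)ᶜ =
      ∅ := by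
  ext ω
  simp only [Set.mem_inter_iff, mem_connEvent, Set.mem_compl_iff, Set.mem_empty_iff_false,
    iff_false, not_and, not_not]
  intro h
  exact conn_trans h.1.1 (conn_symm (conn_a1_of_conn_leaf hl ω h2 h.2))

omit [Fintype V] [DecidableEq V] [LinearOrder R] [IsStrictOrderedRing R] in
/-- The `o`-mass `P(Q, b ∈ C₂, a₃ ∈ C₁, o ∈ C₂)` factors. -/
lemma prob_ob₁ (p : E → R) (hl : IsLeafAt ends b o e₀) (h1 : a₁ ≠ o) (h2 : a₂ ≠ o) (h3 : a₃ ≠ o) :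
    prob p (connEvent ends a₂ b ∩ connEvent ends a₁ a₃ ∩ connEvent ends a₂ o ∩
      (connEvent ends a₁ a₂)ᶜ) =
      p e₀ * prob p (connEvent ends a₂ b ∩ connEvent ends a₁ a₃ ∩ (connEvent ends a₁ a₂)ᶜ) := by
  rw [ob_event_eq₁ hl h2, prob_connEvent_leaf_inter p hl]
  intro ω c
  simp only [Set.mem_inter_iff, Set.mem_compl_iff]
  rw [mem_connEvent_update_of_leaf hl ω c h2 hl.ne, mem_connEvent_update_of_leaf hl ω c h1 h3,
    mem_connEvent_update_of_leaf hl ω c h1 h2]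

omit [Fintype V] [DecidableEq V] [LinearOrder R] [IsStrictOrderedRing R] in
/-- The `o`-mass `P(Q, a₃ ∈ C₁, o ∈ C₂)` factors. -/
lemma prob_ob₂ (p : E → R) (hl : IsLeafAt ends b o e₀) (h1 : a₁ ≠ o) (h2 : a₂ ≠ o) (h3 : a₃ ≠ o) :
    prob p (connEvent ends a₁ a₃ ∩ connEvent ends a₂ o ∩ (connEvent ends a₁ a₂)ᶜ) =
      p e₀ * prob p (connEvent ends a₂ b ∩ connEvent ends a₁ a₃ ∩ (connEvent ends a₁ a₂)ᶜ) := by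
  rw [ob_event_eq₂ hl h2, prob_connEvent_leaf_inter p hl]
  intro ω c
  simp only [Set.mem_inter_iff, Set.mem_compl_iff]
  rw [mem_connEvent_update_of_leaf hl ω c h2 hl.ne, mem_connEvent_update_of_leaf hl ω c h1 h3,
    mem_connEvent_update_of_leaf hl ω c h1 h2]

/-- **`(ii-t)` for `o` a leaf at `b`**, at every pair with `c₀, c₁ ≥ 0`. -/
theorem iiExprT_nonneg_of_o_leaf_b {p : E → R} (hp : IsProbVec p) (hl : IsLeafAt ends b o e₀)
    (h1 : a₁ ≠ o) (h2 : a₂ ≠ o) (h3 : a₃ ≠ o) (c₀ c₁ : R) (hc₀ : 0 ≤ c₀) (hc₁ : 0 ≤ c₁) :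
    0 ≤ iiExprT p ends o a₁ a₂ a₃ b c₀ c₁ := by
  rw [iiExprT_eq, prob_ob₁ p hl h1 h2 h3, prob_ob₂ p hl h1 h2 h3]
  have hbhk := bhk_cross_cluster p hp ends a₂ a₁ (isUpperSet_mem_setOf b) (isUpperSet_mem_setOf a₃)
  rw [← connEvent_eq_clusterInEvent ends a₂ b, ← connEvent_eq_clusterInEvent ends a₁ a₃,
    connEvent_comm ends a₂ a₁] at hbhk
  have hmono : prob p (connEvent ends a₂ b ∩ (connEvent ends a₁ a₂)ᶜ) ≤
      prob p (connEvent ends a₁ a₂)ᶜ :=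
    prob_mono hp Set.inter_subset_right
  have hx : 0 ≤ prob p (connEvent ends a₂ b ∩ connEvent ends a₁ a₃ ∩ (connEvent ends a₁ a₂)ᶜ) :=
    prob_nonneg hp _
  have t1 := mul_nonneg (mul_nonneg (mul_nonneg hc₁ (hp.nonneg e₀)) hx) (sub_nonneg.mpr hmono)
  have t2 := mul_nonneg hc₀ (sub_nonneg.mpr hbhk)
  linear_combination t1 + t2

/-- **`(i-t)` for `o` a leaf at `b`**, at every pair with `c₀, c₁ ≥ 0`. -/
theorem iExprT_nonneg_of_o_leaf_b {p : E → R} (hp : IsProbVec p) (hl : IsLeafAt ends b o e₀)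
    (h1 : a₁ ≠ o) (h2 : a₂ ≠ o) (h3 : a₃ ≠ o) (c₀ c₁ : R) (hc₀ : 0 ≤ c₀) (hc₁ : 0 ≤ c₁) :
    0 ≤ iExprT p ends o a₁ a₂ a₃ b c₀ c₁ := by
  rw [iExprT_eq, ob_event_eq_empty hl h2, prob_empty, prob_ob₂ p hl h1 h2 h3]
  have hbhk := bhk_same_cluster_events p hp ends a₁ a₂ (isUpperSet_mem_setOf b)
    (isUpperSet_mem_setOf a₃)
  rw [← connEvent_eq_clusterInEvent ends a₁ b, ← connEvent_eq_clusterInEvent ends a₁ a₃] at hbhk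
  have hx : 0 ≤ prob p (connEvent ends a₂ b ∩ connEvent ends a₁ a₃ ∩ (connEvent ends a₁ a₂)ᶜ) :=
    prob_nonneg hp _
  have hy : 0 ≤ prob p (connEvent ends a₁ b ∩ (connEvent ends a₁ a₂)ᶜ) := prob_nonneg hp _
  have t1 := mul_nonneg (mul_nonneg (mul_nonneg hc₁ (hp.nonneg e₀)) hy) hx
  have t2 := mul_nonneg hc₀ (sub_nonneg.mpr hbhk)
  linear_combination t1 + t2

/-- **The four case-1 forms at every statement vertex `a₃ ≠ o` when `o` is a leaf at `b`.** -/
theorem fourForms_of_o_leaf_b {p : E → R} (hp : IsProbVec p) (hl : IsLeafAt ends b o e₀)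
    (h1 : a₁ ≠ o) (h2 : a₂ ≠ o) (h3 : a₃ ≠ o) : FourForms p ends o a₁ a₂ a₃ b := by
  have hD : 0 ≤ Dpd p ends a₁ a₂ a₃ := prob_nonneg hp _
  have hDo : 0 ≤ Dpdo p ends o a₁ a₂ a₃ := prob_nonneg hp _
  have hQ : 0 ≤ prob p (connEvent ends a₁ a₂)ᶜ := prob_nonneg hp _
  have hQo : 0 ≤ Dqo p ends o a₁ a₂ := prob_nonneg hp _
  refine ⟨?_, ?_, ?_, ?_⟩
  · unfold ZSplitII
    rw [iiExpr_eq_iiExprT]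
    exact iiExprT_nonneg_of_o_leaf_b hp hl h1 h2 h3 _ _ hDo hD
  · exact iiExprT_nonneg_of_o_leaf_b hp hl h1 h2 h3 _ _ hQo hQ
  · unfold ZSplitI
    rw [iExpr_eq_iExprT]
    exact iExprT_nonneg_of_o_leaf_b hp hl h1 h2 h3 _ _ hDo hD
  · exact iExprT_nonneg_of_o_leaf_b hp hl h1 h2 h3 _ _ hQo hQ

end OLeafB

/-! ## `b` a leaf at `o` -/

section BLeafO
variable {V : Type*} {E : Type*} [Fintype E] [DecidableEq E] [Fintype V] [DecidableEq V]
  {R : Type*} [CommRing R] [LinearOrder R] [IsStrictOrderedRing R]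
variable {ends : E → Sym2 V} {o a₁ a₂ a₃ b : V} {e₀ : E}

omit [Fintype E] [DecidableEq E] [Fintype V] [DecidableEq V] in
/-- `{b ∈ C₂} ∩ {a₃ ∈ C₁} ∩ {o ∈ C₂} ∩ Q = {o ↔ b} ∩ ({a₃ ∈ C₁} ∩ {o ∈ C₂} ∩ Q)` for `b` a leaf at `o`. -/
lemma bo_event_eq₁ (hl : IsLeafAt ends o b e₀) (h2 : a₂ ≠ b) :
    connEvent ends a₂ b ∩ connEvent ends a₁ a₃ ∩ connEvent ends a₂ o ∩ (connEvent ends a₁ a₂)ᶜ =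
      connEvent ends o b ∩ (connEvent ends a₁ a₃ ∩ connEvent ends a₂ o ∩
        (connEvent ends a₁ a₂)ᶜ) := by
  ext ω
  simp only [Set.mem_inter_iff, mem_connEvent, Set.mem_compl_iff]
  rw [conn_leaf_at_iff hl ω h2, conn_leaf_iff hl ω]
  tauto

omit [Fintype E] [DecidableEq E] [Fintype V] [DecidableEq V] in
/-- `{b ∈ C₂} ∩ Q = {o ↔ b} ∩ ({o ∈ C₂} ∩ Q)` for `b` a leaf at `o`. -/
lemma bo_event_eq₂ (hl : IsLeafAt ends o b e₀) (h2 : a₂ ≠ b) :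
    connEvent ends a₂ b ∩ (connEvent ends a₁ a₂)ᶜ =
      connEvent ends o b ∩ (connEvent ends a₂ o ∩ (connEvent ends a₁ a₂)ᶜ) := by
  ext ω
  simp only [Set.mem_inter_iff, mem_connEvent, Set.mem_compl_iff]
  rw [conn_leaf_at_iff hl ω h2, conn_leaf_iff hl ω]
  tauto

omit [Fintype E] [DecidableEq E] [Fintype V] [DecidableEq V] in
/-- `{b ∈ C₂} ∩ {a₃ ∈ C₁} ∩ Q = {o ↔ b} ∩ ({a₃ ∈ C₁} ∩ {o ∈ C₂} ∩ Q)` for `b` a leaf at `o`. -/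
lemma bo_event_eq₃ (hl : IsLeafAt ends o b e₀) (h2 : a₂ ≠ b) :
    connEvent ends a₂ b ∩ connEvent ends a₁ a₃ ∩ (connEvent ends a₁ a₂)ᶜ =
      connEvent ends o b ∩ (connEvent ends a₁ a₃ ∩ connEvent ends a₂ o ∩
        (connEvent ends a₁ a₂)ᶜ) := by
  ext ω
  simp only [Set.mem_inter_iff, mem_connEvent, Set.mem_compl_iff]
  rw [conn_leaf_at_iff hl ω h2, conn_leaf_iff hl ω]
  tauto

omit [Fintype E] [DecidableEq E] [Fintype V] [DecidableEq V] in
/-- `{b ∈ C₁} ∩ {a₃ ∈ C₁} ∩ {o ∈ C₂} ∩ Q = ∅` for `b` a leaf at `o`: `b ∈ C₁` forces `o ∈ C₁`. -/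
lemma bo_event_eq_empty (hl : IsLeafAt ends o b e₀) (h1 : a₁ ≠ b) :
    connEvent ends a₁ b ∩ connEvent ends a₁ a₃ ∩ connEvent ends a₂ o ∩ (connEvent ends a₁ a₂)ᶜ =
      ∅ := by
  ext ω
  simp only [Set.mem_inter_iff, mem_connEvent, Set.mem_compl_iff, Set.mem_empty_iff_false,
    iff_false, not_and, not_not]
  intro h
  exact conn_trans (conn_a1_of_conn_leaf hl ω h1 h.1.1) (conn_symm h.2)

omit [Fintype E] [DecidableEq E] [Fintype V] [DecidableEq V] in
/-- `{b ∈ C₁} ∩ Q = {o ↔ b} ∩ ({o ∈ C₁} ∩ Q)` for `b` a leaf at `o`. -/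
lemma bo_event_eq₄ (hl : IsLeafAt ends o b e₀) (h1 : a₁ ≠ b) :
    connEvent ends a₁ b ∩ (connEvent ends a₁ a₂)ᶜ =
      connEvent ends o b ∩ (connEvent ends a₁ o ∩ (connEvent ends a₁ a₂)ᶜ) := by
  ext ω
  simp only [Set.mem_inter_iff, mem_connEvent, Set.mem_compl_iff]
  rw [conn_leaf_at_iff hl ω h1, conn_leaf_iff hl ω]
  tauto

omit [Fintype E] [DecidableEq E] [Fintype V] [DecidableEq V] in
/-- `{b ∈ C₁} ∩ {a₃ ∈ C₁} ∩ Q = {o ↔ b} ∩ ({o ∈ C₁} ∩ {a₃ ∈ C₁} ∩ Q)` for `b` a leaf at `o`. -/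
lemma bo_event_eq₅ (hl : IsLeafAt ends o b e₀) (h1 : a₁ ≠ b) :
    connEvent ends a₁ b ∩ connEvent ends a₁ a₃ ∩ (connEvent ends a₁ a₂)ᶜ =
      connEvent ends o b ∩ (connEvent ends a₁ o ∩ connEvent ends a₁ a₃ ∩
        (connEvent ends a₁ a₂)ᶜ) := by
  ext ω
  simp only [Set.mem_inter_iff, mem_connEvent, Set.mem_compl_iff]
  rw [conn_leaf_at_iff hl ω h1, conn_leaf_iff hl ω]
  tauto

/-- **`(ii-t)` for `b` a leaf at `o`**, at every pair with `c₀, c₁ ≥ 0`. -/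
theorem iiExprT_nonneg_of_b_leaf_o {p : E → R} (hp : IsProbVec p) (hl : IsLeafAt ends o b e₀)
    (h1 : a₁ ≠ b) (h2 : a₂ ≠ b) (h3 : a₃ ≠ b) (c₀ c₁ : R) (hc₀ : 0 ≤ c₀) (hc₁ : 0 ≤ c₁) :
    0 ≤ iiExprT p ends o a₁ a₂ a₃ b c₀ c₁ := by
  have ho : o ≠ b := hl.ne
  rw [iiExprT_eq, bo_event_eq₁ hl h2, bo_event_eq₂ hl h2, bo_event_eq₃ hl h2,
    prob_connEvent_leaf_inter p hl, prob_connEvent_leaf_inter p hl]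
  · have hbhk := bhk_cross_cluster p hp ends a₂ a₁ (isUpperSet_mem_setOf o)
      (isUpperSet_mem_setOf a₃)
    rw [← connEvent_eq_clusterInEvent ends a₂ o, ← connEvent_eq_clusterInEvent ends a₁ a₃,
      connEvent_comm ends a₂ a₁, Set.inter_comm (connEvent ends a₂ o) (connEvent ends a₁ a₃)] at hbhk
    have hmono : prob p (connEvent ends a₂ o ∩ (connEvent ends a₁ a₂)ᶜ) ≤
        prob p (connEvent ends a₁ a₂)ᶜ :=
      prob_mono hp Set.inter_subset_right
    have hx : 0 ≤ prob p (connEvent ends a₁ a₃ ∩ connEvent ends a₂ o ∩ (connEvent ends a₁ a₂)ᶜ) :=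
      prob_nonneg hp _
    have t1 := mul_nonneg (mul_nonneg (mul_nonneg hc₁ (hp.nonneg e₀)) hx) (sub_nonneg.mpr hmono)
    have t2 := mul_nonneg (mul_nonneg hc₀ (hp.nonneg e₀)) (sub_nonneg.mpr hbhk)
    linear_combination t1 + t2
  · intro ω c
    simp only [Set.mem_inter_iff, Set.mem_compl_iff]
    rw [mem_connEvent_update_of_leaf hl ω c h2 ho, mem_connEvent_update_of_leaf hl ω c h1 h2]
  · intro ω c
    simp only [Set.mem_inter_iff, Set.mem_compl_iff]
    rw [mem_connEvent_update_of_leaf hl ω c h1 h3, mem_connEvent_update_of_leaf hl ω c h2 ho,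
      mem_connEvent_update_of_leaf hl ω c h1 h2]

/-- **`(i-t)` for `b` a leaf at `o`**, at every pair with `c₀, c₁ ≥ 0`. -/
theorem iExprT_nonneg_of_b_leaf_o {p : E → R} (hp : IsProbVec p) (hl : IsLeafAt ends o b e₀)
    (h1 : a₁ ≠ b) (h2 : a₂ ≠ b) (h3 : a₃ ≠ b) (c₀ c₁ : R) (hc₀ : 0 ≤ c₀) (hc₁ : 0 ≤ c₁) :
    0 ≤ iExprT p ends o a₁ a₂ a₃ b c₀ c₁ := by
  have ho : o ≠ b := hl.ne
  rw [iExprT_eq, bo_event_eq_empty hl h1, prob_empty, bo_event_eq₄ hl h1, bo_event_eq₅ hl h1,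
    prob_connEvent_leaf_inter p hl, prob_connEvent_leaf_inter p hl]
  · have hbhk := bhk_same_cluster_events p hp ends a₁ a₂ (isUpperSet_mem_setOf o)
      (isUpperSet_mem_setOf a₃)
    rw [← connEvent_eq_clusterInEvent ends a₁ o, ← connEvent_eq_clusterInEvent ends a₁ a₃] at hbhk
    have hx : 0 ≤ prob p (connEvent ends a₁ a₃ ∩ connEvent ends a₂ o ∩ (connEvent ends a₁ a₂)ᶜ) :=
      prob_nonneg hp _
    have hy : 0 ≤ prob p (connEvent ends a₁ o ∩ (connEvent ends a₁ a₂)ᶜ) := prob_nonneg hp _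
    have t1 := mul_nonneg (mul_nonneg (mul_nonneg hc₁ (hp.nonneg e₀)) hy) hx
    have t2 := mul_nonneg (mul_nonneg hc₀ (hp.nonneg e₀)) (sub_nonneg.mpr hbhk)
    linear_combination t1 + t2
  · intro ω c
    simp only [Set.mem_inter_iff, Set.mem_compl_iff]
    rw [mem_connEvent_update_of_leaf hl ω c h1 ho, mem_connEvent_update_of_leaf hl ω c h1 h3,
      mem_connEvent_update_of_leaf hl ω c h1 h2]
  · intro ω c
    simp only [Set.mem_inter_iff, Set.mem_compl_iff]
    rw [mem_connEvent_update_of_leaf hl ω c h1 ho, mem_connEvent_update_of_leaf hl ω c h1 h2]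

/-- **The four case-1 forms at every statement vertex `a₃ ≠ b` when `b` is a leaf at `o`.** -/
theorem fourForms_of_b_leaf_o {p : E → R} (hp : IsProbVec p) (hl : IsLeafAt ends o b e₀)
    (h1 : a₁ ≠ b) (h2 : a₂ ≠ b) (h3 : a₃ ≠ b) : FourForms p ends o a₁ a₂ a₃ b := by
  have hD : 0 ≤ Dpd p ends a₁ a₂ a₃ := prob_nonneg hp _
  have hDo : 0 ≤ Dpdo p ends o a₁ a₂ a₃ := prob_nonneg hp _
  have hQ : 0 ≤ prob p (connEvent ends a₁ a₂)ᶜ := prob_nonneg hp _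
  have hQo : 0 ≤ Dqo p ends o a₁ a₂ := prob_nonneg hp _
  refine ⟨?_, ?_, ?_, ?_⟩
  · unfold ZSplitII
    rw [iiExpr_eq_iiExprT]
    exact iiExprT_nonneg_of_b_leaf_o hp hl h1 h2 h3 _ _ hDo hD
  · exact iiExprT_nonneg_of_b_leaf_o hp hl h1 h2 h3 _ _ hQo hQ
  · unfold ZSplitI
    rw [iExpr_eq_iExprT]
    exact iExprT_nonneg_of_b_leaf_o hp hl h1 h2 h3 _ _ hDo hD
  · exact iExprT_nonneg_of_b_leaf_o hp hl h1 h2 h3 _ _ hQo hQ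

end BLeafO

/-! ## The closed classes -/

section Closed
variable {V : Type*} [Fintype V] [DecidableEq V] {R : Type*} [Field R] [LinearOrder R]
  [IsStrictOrderedRing R]

universe u

variable {E : Type u} [Fintype E] [DecidableEq E] {ends : E → Sym2 V} {o a₁ a₂ a₃ b : V} {e₀ : E}

/-- **`o` a leaf at `b`: every statement vertex is closed** (`o ∉ {a₁, a₂}`). -/
theorem closedAt_of_o_leaf_b (hl : IsLeafAt ends b o e₀) (h1 : a₁ ≠ o) (h2 : a₂ ≠ o) (a₃ : V) :
    ClosedAt R o a₁ a₂ b E ends a₃ := by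
  by_cases h3 : a₃ = o
  · exact closedAt_of_closedAnchor o a₁ a₂ b E ends a₃ (Or.inl (Or.inl h3))
  · exact fun _ hp => fourForms_of_o_leaf_b hp hl h1 h2 h3

/-- **`b` a leaf at `o`: every statement vertex is closed** (`b ∉ {a₁, a₂}`). -/
theorem closedAt_of_b_leaf_o (hl : IsLeafAt ends o b e₀) (h1 : a₁ ≠ b) (h2 : a₂ ≠ b) (a₃ : V) :
    ClosedAt R o a₁ a₂ b E ends a₃ := by
  by_cases h3 : a₃ = b
  · exact closedAt_of_closedAnchor o a₁ a₂ b E ends a₃ (Or.inl (Or.inr (Or.inr (Or.inr h3))))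
  · exact fun _ hp => fourForms_of_b_leaf_o hp hl h1 h2 h3

variable {W : Set V} {P : Finset E}

/-- **The mark `o` in a mark-free-otherwise pocket hanging at `b`**: every statement vertex outside
the pocket is closed. -/
theorem closedAt_of_o_pocket_b (h : IsPocket ends W b P) (he : e₀ ∈ P) (ho : o ∈ W)
    (h1 : a₁ ∉ W) (h2 : a₂ ∉ W) (ha : a₃ ∉ W) : ClosedAt R o a₁ a₂ b E ends a₃ :=
  closedAt_of_pocket' (z := o) h he (Or.inr rfl) (Or.inl h1) (Or.inl h2) (Or.inl ha)
    (Or.inl h.x_not_mem)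
    (closedAt_of_o_leaf_b (h.isLeafAt_pocketEnds e₀ ho) (by rintro rfl; exact h1 ho)
      (by rintro rfl; exact h2 ho) a₃)

/-- **The mark `b` in a mark-free-otherwise pocket hanging at `o`**: every statement vertex outside
the pocket is closed. -/
theorem closedAt_of_b_pocket_o (h : IsPocket ends W o P) (he : e₀ ∈ P) (hb : b ∈ W)
    (h1 : a₁ ∉ W) (h2 : a₂ ∉ W) (ha : a₃ ∉ W) : ClosedAt R o a₁ a₂ b E ends a₃ :=
  closedAt_of_pocket' (z := b) h he (Or.inl h.x_not_mem) (Or.inl h1) (Or.inl h2) (Or.inl ha)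
    (Or.inr rfl)
    (closedAt_of_b_leaf_o (h.isLeafAt_pocketEnds e₀ hb) (by rintro rfl; exact h1 hb)
      (by rintro rfl; exact h2 hb) a₃)

end Closed

end CaseOne

end Summit.Ventures.PercRepro2
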